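import Summits.CriticalPhenomena.CardyFormulaZ2.Theorems.CardyBoundaryCoulombGasRectilinearCardyStubRowBlocksPart2
import Summits.CriticalPhenomena.CardyFormulaZ2.Theorems.CardyBoundaryCoulombGasBoundaryDefectGaussianRStubGreenKernelAsymptoticsPart4
import Literature.Probability.Percolation.TriHalfAnnulus
import HarnessLib

/-!
# Stub B `stub_rowBlocks` of line `excursion-kernel-covariance`, part 9: transcription lemmas
# (crux `RectilinearCardy`, stmt-CriticalPhenomena-5660, route `CardyBoundaryCoulombGas`)

Small bookkeeping lemmas linking the tree's `Site 2`-vocabulary of the line (`boundaryRow`,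
`closureFinset`, `meshPoint`) with the `ℤ × ℤ`-vocabulary of the Baxter–Kelland–Wu collar in which
the ROW BLOCKS stub is stated:

* `rb_closureFinset_eq_image`, `rb_mem_boundaryRow_iff` — the closure polygon read in `ℤ × ℤ` and
  the boundary row as "exactly one of the four `neighbours` outside `V`";
* `rb_site_of_pair_eq` — a site from its coordinate pair;
* `rb_unit_neighbour` — lattice points at squared distance one are the four lattice steps;
* `rb_dsucc_base_dist` — one step of the walk moves the vertex by at most `2δ`;
* `rb_sep_of_dist` — mesh points more than `4δ` apart are `ℓ∞`-separated by `≥ 3` lattice units;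
* `rb_flat_at` — near a straight side the lattice polygon is an exact lattice half-plane about a row
  vertex (the FLATNESS clause of the stub).

All [folklore].
-/

noncomputable section

open Set Metric
open Literature.Probability.RandomPlanarGeometry
open Literature.Probability.LatticeModels (Site meshPoint Orient zdGraph)
open Literature.Probability.LatticeModels.CollarLegModel (Dart dartTip dir dsucc outDart period neighbours)
open Summit.CriticalPhenomena.CardyFormulaZ2.Cruxes.BoundaryDefectGaussianR.RainbowMonomialsInExcursionKernels
  (green_card_filter_toSite green_mem_image_toSite tp_dir_val)
open Literature.Probability.Percolation (site_eta)

namespace Summit.CriticalPhenomena.CardyFormulaZ2.Cruxes.RectilinearCardy.ExcursionKernelCovariance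

/-! ### The closure polygon and its boundary row in `ℤ × ℤ` -/

/-- The closure polygon is the image of `V` under `p ↦ ![p.1, p.2]`. [folklore] -/
theorem rb_closureFinset_eq_image (R : ConformalRectangle) {δ : ℝ} (hδ : 0 < δ) {V : Finset (ℤ × ℤ)}
    (hV : ∀ x : ℤ × ℤ, x ∈ V ↔ meshPoint δ (![x.1, x.2] : Site 2) ∈ closure R.carrier) :
    closureFinset R δ = V.image (fun p : ℤ × ℤ => (![p.1, p.2] : Site 2)) := by
  ext u
  rw [mem_closureFinset_iff R hδ, green_mem_image_toSite, hV, site_eta]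

/-- **The boundary row read in `ℤ × ℤ`**: `y ∈ boundaryRow R δ` iff `(y 0, y 1) ∈ V` and exactly one
of its four `neighbours` lies outside `V`. [folklore] -/
theorem rb_mem_boundaryRow_iff (R : ConformalRectangle) {δ : ℝ} (hδ : 0 < δ) {V : Finset (ℤ × ℤ)}
    (hV : ∀ x : ℤ × ℤ, x ∈ V ↔ meshPoint δ (![x.1, x.2] : Site 2) ∈ closure R.carrier) (y : Site 2) :
    y ∈ boundaryRow R δ ↔ ((y 0, y 1) : ℤ × ℤ) ∈ V ∧ ((neighbours ((y 0, y 1) : ℤ × ℤ)).filter (fun u ↦ u ∉ V)).card = 1 := by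
  rw [mem_boundaryRow_iff, rb_closureFinset_eq_image R hδ hV, green_mem_image_toSite,
    ← green_card_filter_toSite V ((y 0, y 1) : ℤ × ℤ), site_eta]

/-- A site from its coordinate pair. [folklore] -/
theorem rb_site_of_pair_eq {y : Site 2} {x : ℤ × ℤ} (h : ((y 0, y 1) : ℤ × ℤ) = x) : y = (![x.1, x.2] : Site 2) := by
  rw [← h, site_eta]

/-! ### Lattice steps -/

/-- **Lattice points at squared distance one are the four lattice steps.** [folklore] -/
theorem rb_unit_neighbour (w u : ℤ × ℤ) : (w.1 - u.1) ^ 2 + (w.2 - u.2) ^ 2 = 1 ↔ ∃ k : Fin 4, w = u + dir k := by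
  obtain ⟨h0, h1, h2, h3⟩ := tp_dir_val
  constructor
  · intro h
    have ha : (w.1 - u.1) ^ 2 ≤ 1 := by nlinarith [sq_nonneg (w.2 - u.2)]
    have hb : (w.2 - u.2) ^ 2 ≤ 1 := by nlinarith [sq_nonneg (w.1 - u.1)]
    have ha' : -1 ≤ w.1 - u.1 ∧ w.1 - u.1 ≤ 1 := by constructor <;> nlinarith
    have hb' : -1 ≤ w.2 - u.2 ∧ w.2 - u.2 ≤ 1 := by constructor <;> nlinarith
    obtain ⟨a, b⟩ := w
    obtain ⟨c, d⟩ := u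
    simp only at h ha' hb' ⊢
    rcases ha' with ⟨ha1, ha2⟩
    rcases hb' with ⟨hb1, hb2⟩
    have hcase : (a - c = 1 ∧ b - d = 0) ∨ (a - c = 0 ∧ b - d = 1) ∨ (a - c = -1 ∧ b - d = 0) ∨
        (a - c = 0 ∧ b - d = -1) := by
      have h5 : a - c = -1 ∨ a - c = 0 ∨ a - c = 1 := by omega
      have h6 : b - d = -1 ∨ b - d = 0 ∨ b - d = 1 := by omega
      rcases h5 with h5 | h5 | h5 <;> rcases h6 with h6 | h6 | h6 <;>
        first | omega | (rw [h5, h6] at h; norm_num at h)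
    rcases hcase with ⟨p, q⟩ | ⟨p, q⟩ | ⟨p, q⟩ | ⟨p, q⟩
    · exact ⟨0, by rw [h0]; ext <;> simp <;> omega⟩
    · exact ⟨1, by rw [h1]; ext <;> simp <;> omega⟩
    · exact ⟨2, by rw [h2]; ext <;> simp <;> omega⟩
    · exact ⟨3, by rw [h3]; ext <;> simp <;> omega⟩
  · rintro ⟨k, rfl⟩
    fin_cases k <;> simp [h0, h1, h2, h3]

/-- **One step of the walk moves the vertex by at most `2δ`.** [folklore] -/
theorem rb_dsucc_base_dist {δ : ℝ} (hδ : 0 < δ) (V : Finset (ℤ × ℤ)) (d : Dart) :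
    dist (meshPoint δ (![(dsucc V d).1.1, (dsucc V d).1.2] : Site 2)) (meshPoint δ (![d.1.1, d.1.2] : Site 2)) ≤ 2 * δ := by
  obtain ⟨v, k⟩ := d
  obtain ⟨c1, c2, c3⟩ := rb_dsucc_cases V v k
  by_cases hA : v + dir (k + 1) ∈ V
  · by_cases hB : v + dir (k + 1) + dir k ∈ V
    · rw [c3 hA hB]
      have h1 := rb_dist_mesh_dir hδ (v + dir (k + 1)) k
      have h2 := rb_dist_mesh_dir hδ v (k + 1)
      have h3 := dist_triangle (meshPoint δ (![(v + dir (k + 1) + dir k).1, (v + dir (k + 1) + dir k).2] : Site 2))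
        (meshPoint δ (![(v + dir (k + 1)).1, (v + dir (k + 1)).2] : Site 2)) (meshPoint δ (![v.1, v.2] : Site 2))
      simp only at h3 ⊢
      linarith
    · rw [c2 hA hB]
      simp only
      rw [rb_dist_mesh_dir hδ v (k + 1)]
      linarith
  · rw [c1 hA]
    simp only [dist_self]
    linarith

/-- **Mesh points more than `4δ` apart are `ℓ∞`-separated by at least `3` lattice units.** [folklore] -/
theorem rb_sep_of_dist {δ : ℝ} (hδ : 0 < δ) {x y : ℤ × ℤ}
    (h : 4 * δ < dist (meshPoint δ (![x.1, x.2] : Site 2)) (meshPoint δ (![y.1, y.2] : Site 2))) :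
    (3 : ℤ) ≤ max |x.1 - y.1| |x.2 - y.2| := by
  by_contra hlt
  rw [not_le] at hlt
  have h1 : |x.1 - y.1| ≤ 2 := by have := le_max_left |x.1 - y.1| |x.2 - y.2|; omega
  have h2 : |x.2 - y.2| ≤ 2 := by have := le_max_right |x.1 - y.1| |x.2 - y.2|; omega
  have h1' : |((x.1 - y.1 : ℤ) : ℝ)| ≤ 2 := by rw [← Int.cast_abs]; exact_mod_cast h1
  have h2' : |((x.2 - y.2 : ℤ) : ℝ)| ≤ 2 := by rw [← Int.cast_abs]; exact_mod_cast h2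
  have h3 := rb_dist_mesh_le hδ.le x y
  nlinarith

/-! ### Exact lattice half-planes about a row vertex -/

/-- **FLATNESS.** Near a straight side (`Ω̄ = {nrmC o ≥ h}` inside `B(c, r)`), about a row vertex `x`
(`nrm x = ⌈h/δ⌉`) whose mesh point is `ρ + δ`-inside the ball, the lattice polygon is the exact lattice
half-plane `{w : (w - x) · dv ≥ 0}` on the lattice disc of radius `ρ/δ` (`dv` the inward lattice
normal). [folklore] -/
theorem rb_flat_at {Ω : Set ℂ} {V : Finset (ℤ × ℤ)} {δ : ℝ} {o : Orient} {h r ρ : ℝ} {c : ℂ} {dv : ℤ × ℤ}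
    (hV : ∀ x : ℤ × ℤ, x ∈ V ↔ meshPoint δ (![x.1, x.2] : Site 2) ∈ closure Ω) (hδ : 0 < δ) (hρ : 0 ≤ ρ)
    (hcl : ∀ z, dist z c < r → (z ∈ closure Ω ↔ h ≤ Orient.nrmC o z))
    (hdv : ∀ w x : ℤ × ℤ, Orient.nrm o (![w.1, w.2] : Site 2) - Orient.nrm o (![x.1, x.2] : Site 2) =
      (w.1 - x.1) * dv.1 + (w.2 - x.2) * dv.2)
    {x : ℤ × ℤ} (hrow : Orient.nrm o (![x.1, x.2] : Site 2) = ⌈h / δ⌉)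
    (hx : dist (meshPoint δ (![x.1, x.2] : Site 2)) c + ρ < r) :
    ∀ w : ℤ × ℤ, (((w.1 - x.1) ^ 2 + (w.2 - x.2) ^ 2 : ℤ) : ℝ) ≤ (ρ / δ) ^ 2 →
      (w ∈ V ↔ 0 ≤ (w.1 - x.1) * dv.1 + (w.2 - x.2) * dv.2) := by
  intro w hw
  have hdist : dist (meshPoint δ (![w.1, w.2] : Site 2)) (meshPoint δ (![x.1, x.2] : Site 2)) ≤ ρ := by
    have hsq : dist (meshPoint δ (![w.1, w.2] : Site 2)) (meshPoint δ (![x.1, x.2] : Site 2)) ^ 2 =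
        δ ^ 2 * (((w.1 - x.1) ^ 2 + (w.2 - x.2) ^ 2 : ℤ) : ℝ) := by
      rw [dist_eq_norm, Complex.sq_norm, Complex.normSq_apply]
      simp [Literature.Probability.LatticeModels.meshPoint_re, Literature.Probability.LatticeModels.meshPoint_im]
      ring
    have h1 : dist (meshPoint δ (![w.1, w.2] : Site 2)) (meshPoint δ (![x.1, x.2] : Site 2)) ^ 2 ≤ ρ ^ 2 := by
      rw [hsq]
      calc δ ^ 2 * (((w.1 - x.1) ^ 2 + (w.2 - x.2) ^ 2 : ℤ) : ℝ) ≤ δ ^ 2 * (ρ / δ) ^ 2 :=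
            mul_le_mul_of_nonneg_left hw (sq_nonneg δ)
        _ = ρ ^ 2 := by field_simp
    have h2 := Real.sqrt_le_sqrt h1
    rwa [Real.sqrt_sq dist_nonneg, Real.sqrt_sq hρ] at h2
  have hwc : dist (meshPoint δ (![w.1, w.2] : Site 2)) c < r := by
    have := dist_triangle (meshPoint δ (![w.1, w.2] : Site 2)) (meshPoint δ (![x.1, x.2] : Site 2)) c
    linarith
  rw [rb_memV_iff hV hδ hcl hwc, ← hrow]
  have := hdv w x
  constructor
  · intro hle; rw [← this]; omega
  · intro hle; rw [← this] at hle; omega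

end Summit.CriticalPhenomena.CardyFormulaZ2.Cruxes.RectilinearCardy.ExcursionKernelCovariance

end
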